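import Summits.QuantumFields.YangMills.Theorems.PoincareLipschitzConeLinkDilationLetters
import Literature.Analysis.FunctionSpaces.MeyersSerrinProofs
import Mathlib.MeasureTheory.Measure.Haar.NormedSpace
import HarnessLib

/-!
# Crux `BlockLipschitzL` (stmt-QuantumFields-23533) ∕ `HistoryTailL` (stmt-QuantumFields-19936), LINE 25 «CompactnessTransfer»,
# stub S1″ — ROAD (H) «SU(2) currents ⇒ H-system ⇒ 8π quantum», brick (T) «CONE → PLANE TRANSPORT», FILE B «DILATION INVARIANCE»

Cell `ym3-torus` (YM ladder rung R3 = continuum SU(2) Yang–Mills on T³ — a RUNG, NOT Clay: not d = 4, not infinite volume,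
not a mass gap); WIDTH helper seat `ym3-torus-px14` g7 (brick (T) of px19 g8's ROAD (H) memo `ROAD-TM-HSYSTEM-px19g8.md`,
architecture v1: the (GAP) socket of px3 g9).  Helper `--supports stmt-QuantumFields-23533`; THEOREMS ONLY (0 `def`, 0 `sorry`,
default heartbeats); imports FILE B-LETTERS ✓`PoincareLipschitzConeLinkDilationLetters` (radial weak identity, dilated pairing),
lit ✓`SobolevBallScaling` (`HasWeakFDerivOn.comp_affine`, `locallyIntegrableOn_comp_affine`), lit ✓`MeyersSerrinProofs`
(`hasWeakFDerivOn_congr_ae`), lit ✓`SobolevDomainProofs` (`HasWeakFDerivOn.unique_holds`, `mono_set_holds`), Mathlib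
(`Measure.integral_comp_smul`, the fundamental lemma of the calculus of variations `IsOpen.ae_eq_zero_of_integral_contDiff_smul_eq_zero`).

WHAT THIS FILE PROVES.  Let `Ω` be an open subset of a finite-dimensional real inner product space `E` (`dim E = n`) which is
STAR-SHAPED TOWARDS THE ORIGIN (`x ∈ Ω`, `s ≥ 1` ⇒ `s⁻¹ • x ∈ Ω`; balls and cubes centred at `0`), and let `U : E → F` have the
weak gradient `G` on `Ω` (lit `HasWeakFDerivOn Ω volume U G`) with VANISHING RADIAL DERIVATIVE `G x (x) = 0` for a.e. `x ∈ Ω`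
(px3 g9's ✓`radialDeriv_ae_zero_of_ball_linear`: the tangent-map condition).  Then `U` is invariant under dilations and `G` is
homogeneous of degree `−1`, almost everywhere:
* ★★ `integral_smul_comp_inv_smul` : `∫ g(x) • U(s⁻¹•x) dx = ∫ g(x) • U(x) dx` for test functions `g` on `Ω`, `s ≥ 1`;
* ★★★ `ae_eq_comp_inv_smul` : `∀ s ≥ 1, U (s⁻¹ • x) = U x` for a.e. `x ∈ Ω`;
* ★★★ `ae_eq_smul_weakGrad_comp_inv_smul` : `∀ s ≥ 1, G (s⁻¹ • x) = s • G x` for a.e. `x ∈ Ω`.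
Proof («test side only», no regularisation): for a test function `g` on `Ω` the function `K(s) := ∫ g(s•z) • U z dz` is
differentiable for `s > s₀` (`s₀ < 1`, the support of `g(s•·)` staying inside `Ω`) with `K′(s) = ∫ Dg_{sz}(z) • U z dz =
s⁻¹ ∫ D(g∘s•)_z(z) • U z dz`, and the radial weak identity (letters) turns this into `K′ = −(n∕s) K`, i.e. `(sⁿK)′ = 0`; since
`sⁿ K(s) = ∫ g(x) • U(s⁻¹•x) dx` (`dz = s⁻ⁿ dx`), the fundamental lemma gives the second bullet, and the third follows from the
affine chain rule for weak gradients (`D(U ∘ s⁻¹•) = s⁻¹ • G ∘ s⁻¹•`, lit) and the a.e. uniqueness of weak gradients.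

HONEST SCOPE.  Sobolev calculus; nothing of (GAP)∕(TM), (C), S1″, K1, `MeanDeviationL`, `BlockLipschitzL`, `HistoryTailL` is
proved here.  YM₃ on T³ is rung R3, not Clay; YM gap NOT proved; no summit statement is proved here.

References: L. Simon, Theorems on Regularity and Singularity of Energy Minimizing Maps (1996) [Simon1996] (§3.1: tangent maps
are homogeneous of degree zero); L. C. Evans, Partial Differential Equations, 2nd ed. (2010) [Evans2010] (§5.2.1);
R. Schoen, K. Uhlenbeck, Invent. Math. 78 (1984) 89–100 [SchoenUhlenbeck1984] (§1, tangent maps).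
-/

set_option autoImplicit false

noncomputable section

open MeasureTheory Set Function Filter Topology Metric TopologicalSpace Module
open scoped ContDiff

namespace Summit.QuantumFields.YangMills.Theorems.PoincareLipschitzConeLinkDilation

open Literature.Analysis.FunctionSpaces (IsTestFunctionOn HasWeakFDerivOn affinePreimage
  locallyIntegrableOn_comp_affine)
open Literature.Analysis.FunctionSpaces.MeyersSerrin (hasWeakFDerivOn_congr_ae)
open Summit.QuantumFields.YangMills.Theorems.PoincareLipschitzConeLinkDilationLetters

variable {E : Type*} [NormedAddCommGroup E] [InnerProductSpace ℝ E] [FiniteDimensional ℝ E]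
  [MeasurableSpace E] [BorelSpace E]
variable {F : Type*} [NormedAddCommGroup F] [NormedSpace ℝ F]

/-! ## §5 Dilation invariance of `U` and degree `−1` homogeneity of `G` -/

/-- ★★ **THE DILATED PAIRING IS CONSTANT.**  Under the tangent-map condition `G x (x) = 0` a.e. on the star-shaped `Ω`:
`∫ g(x) • U(s⁻¹•x) dx = ∫ g(x) • U(x) dx` for every test function `g` on `Ω` and every `s ≥ 1`
(`K(s) := ∫ g(s•z) • U z dz` satisfies `K′ = −(n∕s)K`, so `sⁿK(s)` is constant, and `sⁿK(s) = ∫ g • U∘(s⁻¹•)`).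
[cite: Simon1996, §3.1] -/
theorem integral_smul_comp_inv_smul {Ω : Opens E}
    (hstar : ∀ x ∈ (Ω : Set E), ∀ s : ℝ, 1 ≤ s → s⁻¹ • x ∈ (Ω : Set E))
    {U : E → F} {G : E → E →L[ℝ] F} (hU : HasWeakFDerivOn Ω volume U G)
    (hrad : ∀ᵐ x ∂(volume.restrict (Ω : Set E)), G x x = 0)
    {g : E → ℝ} (hg : IsTestFunctionOn Ω g) {s : ℝ} (hs : 1 ≤ s) :
    ∫ x, g x • U (s⁻¹ • x) = ∫ x, g x • U x := by
  obtain ⟨s₀, hs₀0, hs₀1, hroom⟩ := exists_inv_smul_mem hstar hg.hasCompactSupport hg.tsupport_subset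
  have hs0 : 0 < s := lt_of_lt_of_le one_pos hs
  set n := finrank ℝ E with hn
  set Kf : ℝ → F := fun τ => ∫ z in (Ω : Set E), g (τ • z) • U z with hKf
  -- `Kf τ` as a whole-space integral
  have hKf_eq : ∀ τ : ℝ, s₀ < τ → Kf τ = ∫ z, g (τ • z) • U z := fun τ hτ =>
    setIntegral_smul_eq_integral (isTestFunctionOn_comp_smul hg (hs₀0.trans hτ).ne' (hroom τ hτ)).tsupport_subset U
  -- the derivative: `Kf′ τ = -(n τ⁻¹) • Kf τ`
  have hderiv : ∀ τ : ℝ, s₀ < τ → HasDerivAt Kf (-(((n : ℝ) * τ⁻¹) • Kf τ)) τ := by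
    intro τ hτ
    have hτ0 : 0 < τ := hs₀0.trans hτ
    have ha0 : 0 < (s₀ + τ) / 2 := by positivity
    have hs₀a : s₀ < (s₀ + τ) / 2 := by linarith
    have haτ : (s₀ + τ) / 2 < τ := by linarith
    have hK : ∀ τ' : ℝ, (s₀ + τ) / 2 ≤ τ' → ∀ x ∈ tsupport g, τ'⁻¹ • x ∈ (Ω : Set E) :=
      fun τ' hτ' => hroom τ' (lt_of_lt_of_le hs₀a hτ')
    have h1 := hasDerivAt_integral_comp_smul hU.locallyIntegrableOn hg ha0 haτ (lt_add_one τ) hK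
    have htest : IsTestFunctionOn Ω (fun z => g (τ • z)) := isTestFunctionOn_comp_smul hg hτ0.ne' (hroom τ hτ)
    -- the value of the derivative
    have hpt : ∀ z, (fderiv ℝ g (τ • z) z) • U z = τ⁻¹ • ((fderiv ℝ (fun z => g (τ • z)) z z) • U z) := by
      intro z
      rw [fderiv_comp_smul, smul_smul]
      congr 1
      rw [FunLike.coe_smul, Pi.smul_apply, smul_eq_mul, ← mul_assoc, inv_mul_cancel₀ hτ0.ne', one_mul]
    have h2 : ∫ z in (Ω : Set E), (fderiv ℝ g (τ • z) z) • U z = -(((n : ℝ) * τ⁻¹) • Kf τ) := by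
      simp_rw [hpt]
      rw [integral_smul, setIntegral_smul_eq_integral
        ((tsupport_fderiv_apply_self_subset _).trans htest.tsupport_subset),
        integral_fderiv_self_smul_of_radial hU hrad htest, ← hKf_eq τ hτ, smul_neg, smul_smul, mul_comm]
    rw [h2] at h1
    exact h1
  -- `J τ := τⁿ • Kf τ` has zero derivative on `(s₀, ∞)`
  have hJ : ∀ τ : ℝ, s₀ < τ → HasDerivAt (fun τ : ℝ => (τ ^ n) • Kf τ) 0 τ := by
    intro τ hτ
    have hτ0 : 0 < τ := hs₀0.trans hτ
    have h1 : HasDerivAt (fun τ : ℝ => (τ ^ n) • Kf τ)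
        ((τ ^ n) • -(((n : ℝ) * τ⁻¹) • Kf τ) + ((n : ℝ) * τ ^ (n - 1)) • Kf τ) τ :=
      (hasDerivAt_pow n τ).smul (hderiv τ hτ)
    refine h1.congr_deriv ?_
    rw [smul_neg, smul_smul, ← neg_smul, ← add_smul]
    suffices h0 : -(τ ^ n * ((n : ℝ) * τ⁻¹)) + (n : ℝ) * τ ^ (n - 1) = 0 by rw [h0, zero_smul]
    rcases Nat.eq_zero_or_pos n with h0 | hpos
    · simp [h0]
    · have h3 : (τ : ℝ) ^ n = τ ^ (n - 1) * τ := (pow_sub_one_mul hpos.ne' τ).symm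
      rw [h3]
      field_simp
      ring
  -- constancy on `[1, s]`
  have hconst : (s ^ n) • Kf s = Kf 1 := by
    have hcont : ContinuousOn (fun τ : ℝ => (τ ^ n) • Kf τ) (Icc 1 s) := fun τ hτ =>
      (hJ τ (lt_of_lt_of_le hs₀1 hτ.1)).continuousAt.continuousWithinAt
    have h := constant_of_has_deriv_right_zero hcont
      (fun τ hτ => (hJ τ (lt_of_lt_of_le hs₀1 hτ.1)).hasDerivWithinAt) s ⟨hs, le_rfl⟩
    simpa only [one_pow, one_smul] using h
  -- the change of variables `x = s • z`
  have hcv : ∫ z, g (s • z) • U z = |(s ^ n)⁻¹| • ∫ x, g x • U (s⁻¹ • x) := by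
    have h := Measure.integral_comp_smul (μ := volume) (fun x => g x • U (s⁻¹ • x)) s
    simp only [smul_smul, inv_mul_cancel₀ hs0.ne', one_smul] at h
    exact h
  -- assemble
  have hK1 : Kf 1 = ∫ x, g x • U x := by
    rw [hKf_eq 1 hs₀1]; simp only [one_smul]
  have hKs : Kf s = |(s ^ n)⁻¹| • ∫ x, g x • U (s⁻¹ • x) := by rw [hKf_eq s (lt_of_lt_of_le hs₀1 hs), hcv]
  rw [← hK1, ← hconst, hKs, smul_smul, abs_of_pos (by positivity), mul_inv_cancel₀ (by positivity), one_smul]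

variable [CompleteSpace F]

/-- ★★★ **DILATION INVARIANCE.**  Let `Ω` be open and star-shaped towards `0` (`x ∈ Ω`, `s ≥ 1` ⇒ `s⁻¹•x ∈ Ω`), let `U` have
the weak gradient `G` on `Ω` with `G x (x) = 0` for a.e. `x ∈ Ω` (radially constant).  Then for every `s ≥ 1`,
`U (s⁻¹ • x) = U x` for a.e. `x ∈ Ω`: `U` is (a.e.) homogeneous of degree zero. [cite: Simon1996, §3.1 (tangent maps are homogeneous of degree zero)] -/
theorem ae_eq_comp_inv_smul {Ω : Opens E}
    (hstar : ∀ x ∈ (Ω : Set E), ∀ s : ℝ, 1 ≤ s → s⁻¹ • x ∈ (Ω : Set E))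
    {U : E → F} {G : E → E →L[ℝ] F} (hU : HasWeakFDerivOn Ω volume U G)
    (hrad : ∀ᵐ x ∂(volume.restrict (Ω : Set E)), G x x = 0) {s : ℝ} (hs : 1 ≤ s) :
    ∀ᵐ x ∂(volume.restrict (Ω : Set E)), U (s⁻¹ • x) = U x := by
  have hs0 : 0 < s := lt_of_lt_of_le one_pos hs
  -- local integrability of `U ∘ (s⁻¹•)` on `Ω`
  have hsub : (Ω : Set E) ⊆ (affinePreimage s⁻¹ (0 : E) Ω : Set E) := fun x hx => by
    rw [Literature.Analysis.FunctionSpaces.coe_affinePreimage, mem_preimage, zero_add]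
    exact hstar x hx s hs
  have hloc : LocallyIntegrableOn (fun x => U (s⁻¹ • x)) (Ω : Set E) volume := by
    have h := (locallyIntegrableOn_comp_affine (inv_pos.2 hs0) (0 : E) hU.locallyIntegrableOn).mono_set hsub
    simpa only [zero_add] using h
  have h := Ω.isOpen.ae_eq_zero_of_integral_contDiff_smul_eq_zero (hloc.sub hU.locallyIntegrableOn) ?_
  · rw [ae_restrict_iff' Ω.isOpen.measurableSet]
    filter_upwards [h] with x hx hxΩ
    exact sub_eq_zero.1 (hx hxΩ)
  intro g hg hgc hgΩ
  have htest : IsTestFunctionOn Ω g := ⟨hg, hgc, hgΩ⟩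
  have hI1 : Integrable (fun x => g x • U (s⁻¹ • x)) volume :=
    integrable_smul_of_locallyIntegrableOn hloc hg.continuous hgc hgΩ
  have hI2 : Integrable (fun x => g x • U x) volume :=
    integrable_smul_of_locallyIntegrableOn hU.locallyIntegrableOn hg.continuous hgc hgΩ
  simp_rw [Pi.sub_apply, smul_sub]
  rw [integral_sub hI1 hI2, integral_smul_comp_inv_smul hstar hU hrad htest hs, sub_self]

/-- ★★★ **THE WEAK GRADIENT OF A RADIALLY CONSTANT MAP IS HOMOGENEOUS OF DEGREE `−1`.**  Under the hypotheses of
`ae_eq_comp_inv_smul`, for every `s ≥ 1`: `G (s⁻¹ • x) = s • G x` for a.e. `x ∈ Ω` (the affine chain rule gives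
`U ∘ (s⁻¹•)` the weak gradient `s⁻¹ • G ∘ (s⁻¹•)` on `Ω`; `U ∘ (s⁻¹•) = U` a.e.; weak gradients are a.e. unique).
[cite: Simon1996, §3.1] -/
theorem ae_eq_smul_weakGrad_comp_inv_smul {Ω : Opens E}
    (hstar : ∀ x ∈ (Ω : Set E), ∀ s : ℝ, 1 ≤ s → s⁻¹ • x ∈ (Ω : Set E))
    {U : E → F} {G : E → E →L[ℝ] F} (hU : HasWeakFDerivOn Ω volume U G)
    (hrad : ∀ᵐ x ∂(volume.restrict (Ω : Set E)), G x x = 0) {s : ℝ} (hs : 1 ≤ s) :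
    ∀ᵐ x ∂(volume.restrict (Ω : Set E)), G (s⁻¹ • x) = s • G x := by
  have hs0 : 0 < s := lt_of_lt_of_le one_pos hs
  have hle : Ω ≤ affinePreimage s⁻¹ (0 : E) Ω := fun x hx => by
    change x ∈ ((affinePreimage s⁻¹ (0 : E) Ω : Opens E) : Set E)
    rw [Literature.Analysis.FunctionSpaces.coe_affinePreimage, mem_preimage, zero_add]
    exact hstar x hx s hs
  -- the dilated map and its weak gradient on `Ω`
  have h1 : HasWeakFDerivOn Ω volume (fun y => U ((0 : E) + s⁻¹ • y)) (fun y => s⁻¹ • G ((0 : E) + s⁻¹ • y)) :=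
    Literature.Analysis.FunctionSpaces.HasWeakFDerivOn.mono_set_holds (hU.comp_affine (inv_pos.2 hs0) (0 : E)) hle
  -- replace `U ∘ (s⁻¹•)` by `U` (a.e. equal) and clean `0 + ·`
  have h2 : HasWeakFDerivOn Ω volume U (fun y => s⁻¹ • G (s⁻¹ • y)) := by
    refine hasWeakFDerivOn_congr_ae h1 ?_ (Filter.Eventually.of_forall fun y => by simp only [zero_add])
    filter_upwards [ae_eq_comp_inv_smul hstar hU hrad hs] with y hy
    rw [zero_add, hy]
  -- uniqueness of weak gradients
  have h3 := Literature.Analysis.FunctionSpaces.HasWeakFDerivOn.unique_holds h2 hU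
  filter_upwards [h3] with x hx
  have h4 : G (s⁻¹ • x) = s • (s⁻¹ • G (s⁻¹ • x)) := by rw [smul_smul, mul_inv_cancel₀ hs0.ne', one_smul]
  rw [h4, hx]

end Summit.QuantumFields.YangMills.Theorems.PoincareLipschitzConeLinkDilation

end
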